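import Literature.NumberTheory.Sieve.GallagherGoodLevels
import Literature.NumberTheory.LFunctions.KMVSignedSecondGap
import Literature.NumberTheory.LFunctions.KMVAmplifiedDiagonalForms
import Literature.NumberTheory.LFunctions.KMVMomentAsymptoticsUniqueness
import HarnessLib

/-!
# Route `PrimeLevelFamEdge`, crux K_B `BeyondDiagonalBeatsQuarter` (stmt-Parity-20343), line
# `diagonal_kernel_split` rev 2: the CLEAN-SCALES pack (STUB-PLAN helper H1′)

The reshaped heart of the line is H⁻_io,U (`stub_kernelExcessBelowSlack_io`): for `Δ′` in a window
`(1, b)` a tolerance `U < 4(Δ′−1)/Δ′` and, beyond every threshold, a good prime `q` (`q̂^{Δ′} ∉ ℕ`) with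
`re Q^h(X²,1;q̂^{Δ′}) − 2q̂·Σ_{m₁,m₂} x x·kmvKernel(log q̂) ≤ U·mainScaleReal Δ′ q`
(`x_m = μ(m)ψ(m)⁻¹(log(M/m)/log M)²`, `M = q̂^{Δ′}`). Plan Ω of the STUB-PLAN
(`Cruxes/BeyondDiagonalBeatsQuarter/STUB-PLAN-stub_kernelDiagonalUpperOnPrimeAverageXSq.md` §3–§4) proves it
through a BLOCK bound at CLEAN SCALES: scales `N` at which no primitive Dirichlet character of conductor
`1 < D ≤ N^{η′}` has a real zero in `[1 − a₀/log N, 1)` — there the exceptional / near-`1` resonance that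
makes every `∀N`-form (A)-false is `e^{−Ω(a₀)}`-damped (§4.3). This file lands the plan's lever and glue,
all PROVED, route-independent (Literature imports only):
* `CleanScale a₀ η′ N` — the cleanliness predicate (all primitive characters of conductor `1 < D ≤ N^{η′}`,
  not only quadratic ones: this is what Landau–Page gives, and it is the stronger hypothesis for the analyst);
* `cleanScales_io` — **clean scales recur (Landau–Page)**: for every `a₀ > 0` there is `η₀ = c′₀/a₀ > 0`
  such that for `0 < η′ < η₀` clean scales exist beyond every bound; a 20-line adapter of the tree's
  `Literature.NumberTheory.Sieve.MontgomeryVaughan1975.exists_level_without_exceptionalZero`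
  (GallagherGoodLevels.lean :458; Page's theorem `exists_exceptionalZero_unique`, MNT I Cor. 11.10);
* `cleanScale_of_le` — cleanliness propagates up a window: `(a₀, η″)`-clean at `N` ⇒ `(a₀, η′)`-clean at
  every `N′ ≥ N` with `N′^{η′} ≤ N^{η″}` (so clean scales come in windows `[N, N^{η″/η′}]`);
* `kernelExcess Δ′ q` — the pointwise kernel excess (total in `q`), `kernelExcess_eq` its unfolding at `q ≠ 0`
  to the registered stub's left side VERBATIM;
* `kernelExcess_io_of_block_io` — «a block sum `≤ U·Σ ms` over a non-empty block of good primes has a term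
  `≤ U·ms_q`»: block control infinitely often ⇒ the pointwise i.o. control of the stub;
* `kernelExcessBelowSlack_io_of_blockAtCleanScales` — **plan Ω's composition**: a block bound with tolerance
  `U < slack` at all large `(a₀, η′)`-CLEAN scales (the analyst picks `a₀`, is handed any `η₀ > 0`, and
  answers with a window `b` and an `η′ < η₀`) implies the registered heart `stub_kernelExcessBelowSlack_io`
  VERBATIM (conclusion spelled out; no route import).
Nothing here asserts the heart, the block bound, or any moment statement (OPEN; famE-02-class); Landau–Page
SELECTS scales, it excludes no exceptional zero. Standard axioms. «The programme SEARCHES and TYPES; no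
claim about Landau–Siegel zeros, Theorems 1–2 of arXiv:2211.02515 or a repaired Margin232 until a kernel
theorem says so.»
-/

noncomputable section

open Finset Polynomial
open scoped Real

namespace Summit.Parity.GeneralizedHardyLittlewood.Theorems.BeyondDiagonalBeatsQuarter

open Literature.NumberTheory.LFunctions
open Literature.NumberTheory.LFunctions.KMV2000

/-! ## Clean scales -/

/-- **Clean scale.** `N` is `(a₀, η′)`-clean when no primitive Dirichlet character of conductor
`1 < D ≤ N^{η′}` has a real zero `β` with `1 − a₀/log N ≤ β < 1`. (Complex zeros and all characters are
covered — this is the negation of `MontgomeryVaughan1975.IsExceptionalZero (a₀η′) (N^{η′})` for every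
`(D, χ, β)`; by the classical zero-free region only real zeros of quadratic characters can violate it once
`η′` is small against `a₀`.) [cite: MontgomeryVaughanActa1975, §4 Lemma 4.1 (exceptional zero relative to a level)] -/
def CleanScale (a₀ η' : ℝ) (N : ℕ) : Prop :=
  ∀ (D : ℕ) [NeZero D] (χ : DirichletCharacter ℂ D), 1 < D → (D : ℝ) ≤ (N : ℝ) ^ η' →
    χ.IsPrimitive → ∀ β : ℝ, 1 - a₀ / Real.log N ≤ β → β < 1 → χ.LFunction β ≠ 0

/-- **Clean scales recur (Landau–Page).** For every danger threshold `a₀ > 0` there is `η₀ > 0`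
(`= c′₀/a₀`, `c′₀` the absolute constant of `exists_level_without_exceptionalZero`) such that for every
`0 < η′ < η₀`, `(a₀, η′)`-clean scales exist beyond every bound: with `c = a₀η′ ≤ c′₀` and `θ = η′` the
tree's Landau–Page level theorem supplies `y ≥ N₀` with no exceptional zero relative to `(c, y^{θ})`, and
`1 − c/log(y^{θ}) = 1 − a₀/log y`. [cite: MontgomeryVaughan2007, Cor. 11.10 (Page); MontgomeryVaughanActa1975, §4 Lemma 4.1] -/
theorem cleanScales_io {a₀ : ℝ} (ha₀ : 0 < a₀) :
    ∃ η₀ : ℝ, 0 < η₀ ∧ ∀ η' : ℝ, 0 < η' → η' < η₀ → ∀ N₀ : ℕ, ∃ N : ℕ, N₀ ≤ N ∧ 2 ≤ N ∧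
      CleanScale a₀ η' N := by
  obtain ⟨c₀', hc₀', hL⟩ :=
    Literature.NumberTheory.Sieve.MontgomeryVaughan1975.exists_level_without_exceptionalZero
  refine ⟨c₀' / a₀, by positivity, fun η' hη' hη'₀ N₀ ↦ ?_⟩
  have hc : 0 < a₀ * η' := by positivity
  have hcle : a₀ * η' ≤ c₀' := by
    have := mul_lt_mul_of_pos_left hη'₀ ha₀
    rw [mul_div_cancel₀ _ ha₀.ne'] at this
    exact this.le
  obtain ⟨y, hy, hy2, -, hgood⟩ := hL (a₀ * η') hc hcle η' hη' N₀
  refine ⟨y, hy, hy2, ?_⟩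
  intro D _ χ hD hDle hprim β hβlo hβhi hzero
  apply hgood D χ β
  have hypos : (0 : ℝ) < y := by exact_mod_cast (by omega : 0 < y)
  have hlog : Real.log ((y : ℝ) ^ η') = η' * Real.log y := Real.log_rpow hypos η'
  refine ⟨hprim, ?_, hDle, ?_, hβhi, hzero⟩
  · intro h1
    subst h1
    rw [DirichletCharacter.isPrimitive_def, DirichletCharacter.conductor_one] at hprim
    omega
  · rw [hlog]
    have : a₀ * η' / (η' * Real.log y) = a₀ / Real.log y := by
      rw [mul_comm η', mul_div_mul_right _ _ hη'.ne']
    rw [this]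
    exact hβlo

/-- **Cleanliness propagates up a window.** If `N ≥ 2` is `(a₀, η″)`-clean, `0 ≤ a₀`, and `N ≤ N′` with
`N′^{η′} ≤ N^{η″}`, then `N′` is `(a₀, η′)`-clean: the conductor range shrinks (`D ≤ N′^{η′} ≤ N^{η″}`) and
the zero-free interval shrinks (`1 − a₀/log N ≤ 1 − a₀/log N′`). So one clean scale gives the whole window
`[N, N^{η″/η′}]`. [cite: MontgomeryVaughanActa1975, §4 Lemma 4.1 (monotonicity in the level)] -/
theorem cleanScale_of_le {a₀ η' η'' : ℝ} {N N' : ℕ} (ha₀ : 0 ≤ a₀) (hN : 2 ≤ N) (hNN' : N ≤ N')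
    (hpow : (N' : ℝ) ^ η' ≤ (N : ℝ) ^ η'') (h : CleanScale a₀ η'' N) : CleanScale a₀ η' N' := by
  intro D _ χ hD hDle hprim β hβlo hβhi
  have hN0 : (1 : ℝ) < N := by exact_mod_cast (by omega : 1 < N)
  have hN'0 : (1 : ℝ) < N' := by exact_mod_cast (by omega : 1 < N')
  have hlogN : 0 < Real.log N := Real.log_pos hN0
  have hlogle : Real.log N ≤ Real.log N' := Real.log_le_log (by linarith) (by exact_mod_cast hNN')
  refine h D χ hD (hDle.trans hpow) hprim β ?_ hβhi
  have : a₀ / Real.log N' ≤ a₀ / Real.log N := div_le_div_of_nonneg_left ha₀ hlogN hlogle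
  linarith

/-! ## The pointwise kernel excess and the block ⇒ pointwise step -/

/-- **Pointwise kernel excess** at level `q` and length exponent `Δ′` (total in `q`; `0`-moment at `q = 0`):
`E(Δ′, q) = re Q^h(X², 1; q̂^{Δ′}) − 2q̂·Σ_{m₁,m₂ ≤ q̂^{Δ′}} x_{m₁}x_{m₂}·kmvKernel (log q̂) m₁ m₂`,
`x_m = μ(m)ψ(m)⁻¹(log(q̂^{Δ′}/m)/log q̂^{Δ′})²` — the left side of the registered heart
`stub_kernelExcessBelowSlack_io` (see `kernelExcess_eq`). [cite: KowalskiMichelVanderKam2000, §6 p. 19 (Q^h) and (21)–(23) (diagonal kernel)] -/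
def kernelExcess (Δ' : ℝ) (q : ℕ) : ℝ :=
  (if hq : q = 0 then 0 else
      (haveI : NeZero q := ⟨hq⟩; (KMV2000.QhPQ q (X ^ 2) 1 (KMV2000.qhat q ^ Δ')).re)) -
    2 * KMV2000.qhat q *
      ∑ m₁ ∈ Icc 1 ⌊KMV2000.qhat q ^ Δ'⌋₊, ∑ m₂ ∈ Icc 1 ⌊KMV2000.qhat q ^ Δ'⌋₊,
        ((ArithmeticFunction.moebius m₁ : ℝ) *
            ((KMV2000.psi m₁)⁻¹ * (X ^ 2 : ℝ[X]).eval
              (Real.log (KMV2000.qhat q ^ Δ' / m₁) / Real.log (KMV2000.qhat q ^ Δ')))) *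
          ((ArithmeticFunction.moebius m₂ : ℝ) *
            ((KMV2000.psi m₂)⁻¹ * (X ^ 2 : ℝ[X]).eval
              (Real.log (KMV2000.qhat q ^ Δ' / m₂) / Real.log (KMV2000.qhat q ^ Δ')))) *
          KMV2000.kmvKernel (Real.log (KMV2000.qhat q)) m₁ m₂

/-- Unfolding `kernelExcess` at a non-zero level: verbatim the registered stub's left side.
[cite: KowalskiMichelVanderKam2000, §6 p. 19] -/
theorem kernelExcess_eq (Δ' : ℝ) (q : ℕ) [NeZero q] :
    kernelExcess Δ' q =
      (KMV2000.QhPQ q (X ^ 2) 1 (KMV2000.qhat q ^ Δ')).re -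
        2 * KMV2000.qhat q *
          ∑ m₁ ∈ Icc 1 ⌊KMV2000.qhat q ^ Δ'⌋₊, ∑ m₂ ∈ Icc 1 ⌊KMV2000.qhat q ^ Δ'⌋₊,
            ((ArithmeticFunction.moebius m₁ : ℝ) *
                ((KMV2000.psi m₁)⁻¹ * (X ^ 2 : ℝ[X]).eval
                  (Real.log (KMV2000.qhat q ^ Δ' / m₁) / Real.log (KMV2000.qhat q ^ Δ')))) *
              ((ArithmeticFunction.moebius m₂ : ℝ) *
                ((KMV2000.psi m₂)⁻¹ * (X ^ 2 : ℝ[X]).eval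
                  (Real.log (KMV2000.qhat q ^ Δ' / m₂) / Real.log (KMV2000.qhat q ^ Δ')))) *
              KMV2000.kmvKernel (Real.log (KMV2000.qhat q)) m₁ m₂ := by
  unfold kernelExcess
  rw [dif_neg (NeZero.ne q)]

/-- **Block control infinitely often ⇒ pointwise control infinitely often.** If beyond every bound there
is a block `(N, 2N]` holding a good prime with `Σ_{q ∈ goodPrimes Δ′ N} E(Δ′,q) ≤ U·Σ_{q} mainScaleReal Δ′ q`,
then beyond every threshold there is a good prime `q` with `E(Δ′,q) ≤ U·mainScaleReal Δ′ q` (a sum `≤`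
a sum over a non-empty index set has a term `≤` the corresponding term; membership in `goodPrimes`
supplies `q > N ≥ q₀`, primality and the genericity `q̂^{Δ′} ∉ ℕ`). Pattern:
`KMV2000.secondDefect_small_io_of_average`. [cite: KowalskiMichelVanderKam2000, §2 p. 7 (M ∉ ℤ), §6 p. 19] -/
theorem kernelExcess_io_of_block_io {Δ' U : ℝ}
    (h : ∀ N₀ : ℕ, ∃ N : ℕ, N₀ ≤ N ∧ (KMV2000.goodPrimes Δ' N).Nonempty ∧
      ∑ q ∈ KMV2000.goodPrimes Δ' N, kernelExcess Δ' q ≤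
        U * ∑ q ∈ KMV2000.goodPrimes Δ' N, KMV2000.mainScaleReal Δ' q) :
    ∀ q₀ : ℕ, ∃ q : ℕ, ∃ _ : NeZero q, q₀ ≤ q ∧ q.Prime ∧
      (∀ n : ℕ, (n : ℝ) ≠ KMV2000.qhat q ^ Δ') ∧
        (KMV2000.QhPQ q (X ^ 2) 1 (KMV2000.qhat q ^ Δ')).re -
            2 * KMV2000.qhat q *
              ∑ m₁ ∈ Icc 1 ⌊KMV2000.qhat q ^ Δ'⌋₊, ∑ m₂ ∈ Icc 1 ⌊KMV2000.qhat q ^ Δ'⌋₊,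
                ((ArithmeticFunction.moebius m₁ : ℝ) *
                    ((KMV2000.psi m₁)⁻¹ * (X ^ 2 : ℝ[X]).eval
                      (Real.log (KMV2000.qhat q ^ Δ' / m₁) / Real.log (KMV2000.qhat q ^ Δ')))) *
                  ((ArithmeticFunction.moebius m₂ : ℝ) *
                    ((KMV2000.psi m₂)⁻¹ * (X ^ 2 : ℝ[X]).eval
                      (Real.log (KMV2000.qhat q ^ Δ' / m₂) / Real.log (KMV2000.qhat q ^ Δ')))) *
                  KMV2000.kmvKernel (Real.log (KMV2000.qhat q)) m₁ m₂ ≤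
          U * KMV2000.mainScaleReal Δ' q := by
  intro q₀
  obtain ⟨N, hNge, hNne, hsum⟩ := h q₀
  rw [Finset.mul_sum] at hsum
  obtain ⟨q, hqmem, hqle⟩ := Finset.exists_le_of_sum_le hNne hsum
  obtain ⟨hqN, -, hqp, hqg⟩ := KMV2000.mem_goodPrimes_iff.mp hqmem
  haveI : NeZero q := ⟨hqp.ne_zero⟩
  refine ⟨q, inferInstance, by omega, hqp, fun n ↦ by simpa [KMV2000.qhat] using hqg n, ?_⟩
  rwa [kernelExcess_eq] at hqle

/-! ## Plan Ω's composition: block bound at clean scales ⇒ the registered heart -/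

/-- **Block bound at CLEAN scales ⇒ H⁻_io,U (the registered heart `stub_kernelExcessBelowSlack_io`,
verbatim).** Suppose the analyst exhibits a danger threshold `a₀ > 0` and, handed ANY `η₀ > 0`, a window
`b > 1` such that for every `Δ′ ∈ (1, b)` there are a tolerance `U < 4(Δ′−1)/Δ′`, an exponent
`η′ ∈ (0, η₀)` and an `N₀` with: every `(a₀, η′)`-clean `N ≥ N₀` has a good prime in `(N, 2N]` and block
kernel excess `Σ_{q ∈ goodPrimes Δ′ N} E(Δ′,q) ≤ U·Σ_q mainScaleReal Δ′ q`. Then, because `(a₀, η′)`-clean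
scales recur for `η′ < η₀(a₀)` (`cleanScales_io`, Landau–Page) and a block bound has a good term
(`kernelExcess_io_of_block_io`), the pointwise i.o. heart follows. Pure logic over the two lemmas; the
block bound itself is plan Ω's analytic content (OPEN) and is displayed as the hypothesis.
[cite: MontgomeryVaughan2007, Cor. 11.10 (Page); KowalskiMichelVanderKam2000, §6 p. 19] -/
theorem kernelExcessBelowSlack_io_of_blockAtCleanScales
    (hΩ : ∃ a₀ : ℝ, 0 < a₀ ∧ ∀ η₀ : ℝ, 0 < η₀ → ∃ b : ℝ, 1 < b ∧ ∀ Δ' : ℝ, 1 < Δ' → Δ' < b →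
      ∃ U : ℝ, U < 4 * (Δ' - 1) / Δ' ∧ ∃ η' : ℝ, 0 < η' ∧ η' < η₀ ∧ ∃ N₀ : ℕ, ∀ N : ℕ, N₀ ≤ N →
        CleanScale a₀ η' N → (KMV2000.goodPrimes Δ' N).Nonempty ∧
          ∑ q ∈ KMV2000.goodPrimes Δ' N, kernelExcess Δ' q ≤
            U * ∑ q ∈ KMV2000.goodPrimes Δ' N, KMV2000.mainScaleReal Δ' q) :
    ∃ b : ℝ, 1 < b ∧ ∀ Δ' : ℝ, 1 < Δ' → Δ' < b → ∃ U : ℝ, U < 4 * (Δ' - 1) / Δ' ∧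
      ∀ q₀ : ℕ, ∃ q : ℕ, ∃ _ : NeZero q, q₀ ≤ q ∧ q.Prime ∧
        (∀ n : ℕ, (n : ℝ) ≠ KMV2000.qhat q ^ Δ') ∧
          (KMV2000.QhPQ q (X ^ 2) 1 (KMV2000.qhat q ^ Δ')).re -
              2 * KMV2000.qhat q *
                ∑ m₁ ∈ Icc 1 ⌊KMV2000.qhat q ^ Δ'⌋₊, ∑ m₂ ∈ Icc 1 ⌊KMV2000.qhat q ^ Δ'⌋₊,
                  ((ArithmeticFunction.moebius m₁ : ℝ) *
                      ((KMV2000.psi m₁)⁻¹ * (X ^ 2 : ℝ[X]).eval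
                        (Real.log (KMV2000.qhat q ^ Δ' / m₁) / Real.log (KMV2000.qhat q ^ Δ')))) *
                    ((ArithmeticFunction.moebius m₂ : ℝ) *
                      ((KMV2000.psi m₂)⁻¹ * (X ^ 2 : ℝ[X]).eval
                        (Real.log (KMV2000.qhat q ^ Δ' / m₂) / Real.log (KMV2000.qhat q ^ Δ')))) *
                    KMV2000.kmvKernel (Real.log (KMV2000.qhat q)) m₁ m₂ ≤
            U * KMV2000.mainScaleReal Δ' q := by
  obtain ⟨a₀, ha₀, H⟩ := hΩ
  obtain ⟨η₀, hη₀, Hc⟩ := cleanScales_io ha₀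
  obtain ⟨b, hb, Hb⟩ := H η₀ hη₀
  refine ⟨b, hb, fun Δ' h1 h2 ↦ ?_⟩
  obtain ⟨U, hU, η', hη', hη'₀, N₀, HN⟩ := Hb Δ' h1 h2
  refine ⟨U, hU, kernelExcess_io_of_block_io fun N₁ ↦ ?_⟩
  obtain ⟨N, hN, -, hclean⟩ := Hc η' hη' hη'₀ (max N₀ N₁)
  exact ⟨N, le_trans (le_max_right _ _) hN, HN N (le_trans (le_max_left _ _) hN) hclean⟩

/-! ## Appendix (lead g9, 2026-08-28): the EXPLICIT clean-scale constant and the composition with the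
danger threshold chosen AFTER the length `Δ′`

F2 (`OmegaWindow.lean`, `omega_resonanceRow_empty_of_absolute` / `_nonempty_pointwise`) and its second read
(ls-ref-1 g16, N1) show: if the Ω-g resonance bound at a clean scale comes out η-FREE (`C·e^{−c a₀}·Σms`)
rather than η-proportional (STUB-PLAN §4.3), the composition `kernelExcessBelowSlack_io_of_blockAtCleanScales`
(`a₀` before the window) cannot be fed, but a composition with `a₀ = a₀(Δ′)` can — PROVIDED the analyst knows
the clean-scale bound `c′₀/a₀` as a FUNCTION of `a₀` (an adversarial `η₀` handed after `Δ′` could undercut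
`η = Δ′ − 1`). Both pieces are supplied here, proved: `cleanScales_io_explicit` (one absolute `c′₀` for all
`a₀`) and `kernelExcessBelowSlack_io_of_blockAtCleanScales_pointwise`. -/

/-- **Clean scales recur, explicit constant.** There is ONE absolute `c′₀ > 0` (the constant of the tree's
Landau–Page level theorem `MontgomeryVaughan1975.exists_level_without_exceptionalZero`) such that for every
`a₀ > 0` and every `0 < η′ < c′₀/a₀`, `(a₀, η′)`-clean scales exist beyond every bound.
[cite: MontgomeryVaughan2007, Cor. 11.10 (Page); MontgomeryVaughanActa1975, §4 Lemma 4.1] -/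
theorem cleanScales_io_explicit :
    ∃ c₀' : ℝ, 0 < c₀' ∧ ∀ a₀ : ℝ, 0 < a₀ → ∀ η' : ℝ, 0 < η' → η' < c₀' / a₀ →
      ∀ N₀ : ℕ, ∃ N : ℕ, N₀ ≤ N ∧ 2 ≤ N ∧ CleanScale a₀ η' N := by
  obtain ⟨c₀', hc₀', hL⟩ :=
    Literature.NumberTheory.Sieve.MontgomeryVaughan1975.exists_level_without_exceptionalZero
  refine ⟨c₀', hc₀', fun a₀ ha₀ η' hη' hη'₀ N₀ ↦ ?_⟩
  have hc : 0 < a₀ * η' := by positivity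
  have hcle : a₀ * η' ≤ c₀' := by
    have := mul_lt_mul_of_pos_left hη'₀ ha₀
    rw [mul_div_cancel₀ _ ha₀.ne'] at this
    exact this.le
  obtain ⟨y, hy, hy2, -, hgood⟩ := hL (a₀ * η') hc hcle η' hη' N₀
  refine ⟨y, hy, hy2, ?_⟩
  intro D _ χ hD hDle hprim β hβlo hβhi hzero
  apply hgood D χ β
  have hypos : (0 : ℝ) < y := by exact_mod_cast (by omega : 0 < y)
  have hlog : Real.log ((y : ℝ) ^ η') = η' * Real.log y := Real.log_rpow hypos η'
  refine ⟨hprim, ?_, hDle, ?_, hβhi, hzero⟩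
  · intro h1
    subst h1
    rw [DirichletCharacter.isPrimitive_def, DirichletCharacter.conductor_one] at hprim
    omega
  · rw [hlog]
    have : a₀ * η' / (η' * Real.log y) = a₀ / Real.log y := by
      rw [mul_comm η', mul_div_mul_right _ _ hη'.ne']
    rw [this]
    exact hβlo

/-- **Block bound at clean scales with `a₀ = a₀(Δ′)` ⇒ H⁻_io,U (the registered heart, verbatim).** The
analyst is handed the absolute clean-scale constant `c′₀` FIRST, answers with a window `b`, and for each
`Δ′ ∈ (1, b)` exhibits a tolerance `U < 4(Δ′−1)/Δ′`, a danger threshold `a₀ > 0` (which may depend on `Δ′`,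
hence on `U`), an exponent `η′ ∈ (0, c′₀/a₀)` and an `N₀` such that every `(a₀, η′)`-clean `N ≥ N₀` has a good
prime in `(N, 2N]` and block kernel excess `≤ U·Σ mainScaleReal`. This is the quantifier order under which
an η-FREE resonance bound still closes (`OmegaWindow.omega_resonanceRow_nonempty_pointwise`). Pure logic over
`cleanScales_io_explicit` and `kernelExcess_io_of_block_io`.
[cite: MontgomeryVaughan2007, Cor. 11.10 (Page); KowalskiMichelVanderKam2000, §6 p. 19] -/
theorem kernelExcessBelowSlack_io_of_blockAtCleanScales_pointwise
    (hΩ : ∀ c₀' : ℝ, 0 < c₀' → ∃ b : ℝ, 1 < b ∧ ∀ Δ' : ℝ, 1 < Δ' → Δ' < b →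
      ∃ U : ℝ, U < 4 * (Δ' - 1) / Δ' ∧ ∃ a₀ : ℝ, 0 < a₀ ∧ ∃ η' : ℝ, 0 < η' ∧ η' < c₀' / a₀ ∧
        ∃ N₀ : ℕ, ∀ N : ℕ, N₀ ≤ N → CleanScale a₀ η' N → (KMV2000.goodPrimes Δ' N).Nonempty ∧
          ∑ q ∈ KMV2000.goodPrimes Δ' N, kernelExcess Δ' q ≤
            U * ∑ q ∈ KMV2000.goodPrimes Δ' N, KMV2000.mainScaleReal Δ' q) :
    ∃ b : ℝ, 1 < b ∧ ∀ Δ' : ℝ, 1 < Δ' → Δ' < b → ∃ U : ℝ, U < 4 * (Δ' - 1) / Δ' ∧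
      ∀ q₀ : ℕ, ∃ q : ℕ, ∃ _ : NeZero q, q₀ ≤ q ∧ q.Prime ∧
        (∀ n : ℕ, (n : ℝ) ≠ KMV2000.qhat q ^ Δ') ∧
          (KMV2000.QhPQ q (X ^ 2) 1 (KMV2000.qhat q ^ Δ')).re -
              2 * KMV2000.qhat q *
                ∑ m₁ ∈ Icc 1 ⌊KMV2000.qhat q ^ Δ'⌋₊, ∑ m₂ ∈ Icc 1 ⌊KMV2000.qhat q ^ Δ'⌋₊,
                  ((ArithmeticFunction.moebius m₁ : ℝ) *
                      ((KMV2000.psi m₁)⁻¹ * (X ^ 2 : ℝ[X]).eval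
                        (Real.log (KMV2000.qhat q ^ Δ' / m₁) / Real.log (KMV2000.qhat q ^ Δ')))) *
                    ((ArithmeticFunction.moebius m₂ : ℝ) *
                      ((KMV2000.psi m₂)⁻¹ * (X ^ 2 : ℝ[X]).eval
                        (Real.log (KMV2000.qhat q ^ Δ' / m₂) / Real.log (KMV2000.qhat q ^ Δ')))) *
                    KMV2000.kmvKernel (Real.log (KMV2000.qhat q)) m₁ m₂ ≤
            U * KMV2000.mainScaleReal Δ' q := by
  obtain ⟨c₀', hc₀', Hc⟩ := cleanScales_io_explicit
  obtain ⟨b, hb, Hb⟩ := hΩ c₀' hc₀'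
  refine ⟨b, hb, fun Δ' h1 h2 ↦ ?_⟩
  obtain ⟨U, hU, a₀, ha₀, η', hη', hη'₀, N₀, HN⟩ := Hb Δ' h1 h2
  refine ⟨U, hU, kernelExcess_io_of_block_io fun N₁ ↦ ?_⟩
  obtain ⟨N, hN, -, hclean⟩ := Hc a₀ ha₀ η' hη' hη'₀ (max N₀ N₁)
  exact ⟨N, le_trans (le_max_right _ _) hN, HN N (le_trans (le_max_left _ _) hN) hclean⟩

end Summit.Parity.GeneralizedHardyLittlewood.Theorems.BeyondDiagonalBeatsQuarter
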